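import Summits.Parity.GeneralizedHardyLittlewood.Theorems.PrimeLevelFamEdgeMomentsBeyondDiagonalDiagGenericMonomial
import Summits.Parity.GeneralizedHardyLittlewood.Theorems.PrimeLevelFamEdgeMomentsBeyondDiagonalDiagDecorOrderOneOnePoly
import HarnessLib

/-!
# Route `PrimeLevelFamEdge`, crux K_A `MomentsBeyondDiagonal` (stmt-Parity-20007), line «petersson_layers» v4, stub `stub_diag`:
# **closure of the shape `K·log^eM/log²M + O(log^eM/log³M)` under the linear operations on Selberg weights** (toolkit for the
# GENERIC polynomial side (Poly_ij) of every order `(i,j)`, `…DiagGenericPoly`)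

Second brick of the generic assembly (G3′) (census `Cruxes/MomentsBeyondDiagonal/Lines/petersson_layers_stub_diag_g18_generic.md`).
The order-`(i,j)` weight after the Hecke summation (`…DiagDecorOrderHecke.heckeSum_order_eq i j`) is
`Σ_{a≤i,b≤j} C(i,a)C(j,b)·W_{i−a,j−b}(L;k₁,k₂)·c_{ab}(y)`; its POLYNOMIAL PART replaces each Bose coefficient `c_{ab}(y)` by
`E_{ab} + Σ_{i′≤a,j′≤b} C(a,i′)C(b,j′)((−1)^{j′}+(−1)^{i′})μ_{i′+j′}(−1/2)^N L^{N+1}/(N+1)` (`N = a−i′+b−j′`; the `Π`-form of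
`…DiagRemBoseTwoSeq.abs_doubleSum_bose_rem_le₂ a b`, constants `E : ℕ → ℕ → ℝ`, `μ : ℕ → ℝ` ARBITRARY here). Closure of the shape
`K·log^eM/log²M + O(log^eM/log³M)` under the linear operations on weights (`…DiagDecorShiftedLpow.selbergProd_finset_sum/const_mul`, `…DiagDecorOrderOneOnePoly.selbergProd_add`)
and the generic monomial `…DiagGenericMonomial.exists_selbergHeckeHecke_Lpow_asymp` give:

* `asymp_finset_sum` / `asymp_const_mul` / `asymp_add` — closure of the shape for real sequences;
* `selbergAsymp_congr` / `selbergAsymp_finset_sum` / `selbergAsymp_const_mul` / `selbergAsymp_add` — the same for Selberg forms as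
  functions of their weight
(the block `selbergAsymp_Wblock_Lpow` and (Poly_ij) `selbergAsymp_orderPoly` follow in `…DiagGenericPoly`).

Def-free; theorems only. Helper `--supports stmt-Parity-20007`; closes nothing; K_A, K_B and the Parity summit are NOT proved;
nothing about Landau–Siegel zeros.

## References
* E. Kowalski, P. Michel, J. VanderKam, J. reine angew. Math. 526 (2000), (23)–(28) pp. 13–15 and Prop. 5.1 p. 18.
  [cite: KowalskiMichelVanderKam2000, (23)–(28) — derivation (polynomial part of the order-(i,j) diagonal weight)]
-/

noncomputable section

open scoped Real ArithmeticFunction.Moebius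
open Finset ArithmeticFunction Polynomial MeasureTheory intervalIntegral

namespace Summit.Parity.GeneralizedHardyLittlewood.Theorems.MomentsBeyondDiagonal.DiagKernel

open Literature.NumberTheory.LFunctions Literature.NumberTheory.LFunctions.KMV2000

/-! ### Closure of the shape for real sequences -/

/-- Finite sums preserve the shape `K·log^eM/log²M + O(log^eM/log³M)`. [folklore] -/
theorem asymp_finset_sum {α : Type*} (s : Finset α) (S : α → ℝ → ℝ) (e : ℕ)
    (h : ∀ x ∈ s, ∃ K C : ℝ, ∀ M : ℝ, 3 ≤ M →
      |S x M -
        K * Real.log M ^ (e) / Real.log M ^ 2| ≤ C * Real.log M ^ (e) / Real.log M ^ 3) :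
    ∃ K C : ℝ, ∀ M : ℝ, 3 ≤ M →
      |∑ x ∈ s, S x M -
        K * Real.log M ^ (e) / Real.log M ^ 2| ≤ C * Real.log M ^ (e) / Real.log M ^ 3 := by
  classical
  choose! K C hKC using h
  refine ⟨∑ x ∈ s, K x, ∑ x ∈ s, |C x|, fun M hM ↦ ?_⟩
  have hL : 1 ≤ Real.log M := Literature.NumberTheory.Sieve.one_le_log_of_three_le hM
  have hL0 : 0 < Real.log M := by linarith
  have hsplit : ∑ x ∈ s, S x M - (∑ x ∈ s, K x) * Real.log M ^ e / Real.log M ^ 2 =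
      ∑ x ∈ s, (S x M - K x * Real.log M ^ e / Real.log M ^ 2) := by
    rw [Finset.sum_sub_distrib, Finset.sum_mul, Finset.sum_div]
  rw [hsplit]
  calc |∑ x ∈ s, (S x M - K x * Real.log M ^ e / Real.log M ^ 2)|
      ≤ ∑ x ∈ s, |S x M - K x * Real.log M ^ e / Real.log M ^ 2| := Finset.abs_sum_le_sum_abs _ _
    _ ≤ ∑ x ∈ s, |C x| * Real.log M ^ e / Real.log M ^ 3 := by
        refine Finset.sum_le_sum fun x hx ↦ (hKC x hx M hM).trans ?_
        apply div_le_div_of_nonneg_right _ (pow_nonneg hL0.le _)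
        exact mul_le_mul_of_nonneg_right (le_abs_self _) (pow_nonneg hL0.le _)
    _ = (∑ x ∈ s, |C x|) * Real.log M ^ e / Real.log M ^ 3 := by
        rw [Finset.sum_mul, Finset.sum_div]

/-- Scalars preserve the shape. [folklore] -/
theorem asymp_const_mul (κ : ℝ) (S : ℝ → ℝ) (e : ℕ) (h : ∃ K C : ℝ, ∀ M : ℝ, 3 ≤ M →
      |S M -
        K * Real.log M ^ (e) / Real.log M ^ 2| ≤ C * Real.log M ^ (e) / Real.log M ^ 3) :
    ∃ K C : ℝ, ∀ M : ℝ, 3 ≤ M →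
      |κ * S M -
        K * Real.log M ^ (e) / Real.log M ^ 2| ≤ C * Real.log M ^ (e) / Real.log M ^ 3 := by
  obtain ⟨K, C, h⟩ := h
  refine ⟨κ * K, |κ| * C, fun M hM ↦ ?_⟩
  have h' := h M hM
  have e1 : κ * S M - κ * K * Real.log M ^ e / Real.log M ^ 2 =
      κ * (S M - K * Real.log M ^ e / Real.log M ^ 2) := by ring
  rw [e1, abs_mul]
  calc |κ| * |S M - K * Real.log M ^ e / Real.log M ^ 2| ≤ |κ| * (C * Real.log M ^ e / Real.log M ^ 3) :=
        mul_le_mul_of_nonneg_left h' (abs_nonneg _)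
    _ = |κ| * C * Real.log M ^ e / Real.log M ^ 3 := by ring

/-- Sums of two preserve the shape. [folklore] -/
theorem asymp_add (S T : ℝ → ℝ) (e : ℕ) (hS : ∃ K C : ℝ, ∀ M : ℝ, 3 ≤ M →
      |S M -
        K * Real.log M ^ (e) / Real.log M ^ 2| ≤ C * Real.log M ^ (e) / Real.log M ^ 3) (hT : ∃ K C : ℝ, ∀ M : ℝ, 3 ≤ M →
      |T M -
        K * Real.log M ^ (e) / Real.log M ^ 2| ≤ C * Real.log M ^ (e) / Real.log M ^ 3) :
    ∃ K C : ℝ, ∀ M : ℝ, 3 ≤ M →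
      |(S M + T M) -
        K * Real.log M ^ (e) / Real.log M ^ 2| ≤ C * Real.log M ^ (e) / Real.log M ^ 3 := by
  obtain ⟨K, C, hS⟩ := hS
  obtain ⟨K', C', hT⟩ := hT
  refine ⟨K + K', C + C', fun M hM ↦ ?_⟩
  have e1 : S M + T M - (K + K') * Real.log M ^ e / Real.log M ^ 2 =
      (S M - K * Real.log M ^ e / Real.log M ^ 2) + (T M - K' * Real.log M ^ e / Real.log M ^ 2) := by ring
  rw [e1]
  calc |(S M - K * Real.log M ^ e / Real.log M ^ 2) + (T M - K' * Real.log M ^ e / Real.log M ^ 2)|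
      ≤ |S M - K * Real.log M ^ e / Real.log M ^ 2| + |T M - K' * Real.log M ^ e / Real.log M ^ 2| := abs_add_le _ _
    _ ≤ C * Real.log M ^ e / Real.log M ^ 3 + C' * Real.log M ^ e / Real.log M ^ 3 := add_le_add (hS M hM) (hT M hM)
    _ = (C + C') * Real.log M ^ e / Real.log M ^ 3 := by ring

/-! ### Closure of the shape for Selberg forms as functions of the weight -/

variable (P : ℝ[X])

/-- Pointwise-equal weights (as functions of `M, c, g, k₁, k₂`) carry the shape over. [folklore] -/
theorem selbergAsymp_congr (e : ℕ) (F G : ℝ → ℕ → ℕ → ℕ → ℕ → ℝ) (hFG : ∀ M c g k₁ k₂, F M c g k₁ k₂ = G M c g k₁ k₂)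
    (h : ∃ K C : ℝ, ∀ M : ℝ, 3 ≤ M →
      |∑ c ∈ Icc 1 ⌊M⌋₊, ∑ g ∈ Icc 1 (⌊M⌋₊ / c), (μ g : ℝ) * c *
          ∑ k₁ ∈ Icc 1 (⌊M⌋₊ / (c * g)), ∑ k₂ ∈ Icc 1 (⌊M⌋₊ / (c * g)),
            ((μ (c * g * k₁) : ℝ) * ((psi (c * g * k₁))⁻¹ *
                P.eval (Real.log (M / ((c * g * k₁ : ℕ) : ℝ)) / Real.log M))) / ((c * g * k₁ : ℕ) : ℝ) *
              (((μ (c * g * k₂) : ℝ) * ((psi (c * g * k₂))⁻¹ *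
                P.eval (Real.log (M / ((c * g * k₂ : ℕ) : ℝ)) / Real.log M))) / ((c * g * k₂ : ℕ) : ℝ)) *
              (F M c g k₁ k₂) -
        K * Real.log M ^ (e) / Real.log M ^ 2| ≤ C * Real.log M ^ (e) / Real.log M ^ 3) :
    ∃ K C : ℝ, ∀ M : ℝ, 3 ≤ M →
      |∑ c ∈ Icc 1 ⌊M⌋₊, ∑ g ∈ Icc 1 (⌊M⌋₊ / c), (μ g : ℝ) * c *
          ∑ k₁ ∈ Icc 1 (⌊M⌋₊ / (c * g)), ∑ k₂ ∈ Icc 1 (⌊M⌋₊ / (c * g)),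
            ((μ (c * g * k₁) : ℝ) * ((psi (c * g * k₁))⁻¹ *
                P.eval (Real.log (M / ((c * g * k₁ : ℕ) : ℝ)) / Real.log M))) / ((c * g * k₁ : ℕ) : ℝ) *
              (((μ (c * g * k₂) : ℝ) * ((psi (c * g * k₂))⁻¹ *
                P.eval (Real.log (M / ((c * g * k₂ : ℕ) : ℝ)) / Real.log M))) / ((c * g * k₂ : ℕ) : ℝ)) *
              (G M c g k₁ k₂) -
        K * Real.log M ^ (e) / Real.log M ^ 2| ≤ C * Real.log M ^ (e) / Real.log M ^ 3 := by
  obtain ⟨K, C, h⟩ := h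
  refine ⟨K, C, fun M hM ↦ ?_⟩
  rw [← selbergForm_congr_squarefree P M ⌊M⌋₊ (F M) (G M) fun c g k₁ k₂ _ _ ↦ hFG M c g k₁ k₂]
  exact h M hM

/-- **Finite sums of weights preserve the shape.** [folklore] -/
theorem selbergAsymp_finset_sum {α : Type*} [DecidableEq α] (e : ℕ) (s : Finset α) (F : α → ℝ → ℕ → ℕ → ℕ → ℕ → ℝ)
    (h : ∀ x ∈ s, ∃ K C : ℝ, ∀ M : ℝ, 3 ≤ M →
      |∑ c ∈ Icc 1 ⌊M⌋₊, ∑ g ∈ Icc 1 (⌊M⌋₊ / c), (μ g : ℝ) * c *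
          ∑ k₁ ∈ Icc 1 (⌊M⌋₊ / (c * g)), ∑ k₂ ∈ Icc 1 (⌊M⌋₊ / (c * g)),
            ((μ (c * g * k₁) : ℝ) * ((psi (c * g * k₁))⁻¹ *
                P.eval (Real.log (M / ((c * g * k₁ : ℕ) : ℝ)) / Real.log M))) / ((c * g * k₁ : ℕ) : ℝ) *
              (((μ (c * g * k₂) : ℝ) * ((psi (c * g * k₂))⁻¹ *
                P.eval (Real.log (M / ((c * g * k₂ : ℕ) : ℝ)) / Real.log M))) / ((c * g * k₂ : ℕ) : ℝ)) *
              (F x M c g k₁ k₂) -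
        K * Real.log M ^ (e) / Real.log M ^ 2| ≤ C * Real.log M ^ (e) / Real.log M ^ 3) :
    ∃ K C : ℝ, ∀ M : ℝ, 3 ≤ M →
      |∑ c ∈ Icc 1 ⌊M⌋₊, ∑ g ∈ Icc 1 (⌊M⌋₊ / c), (μ g : ℝ) * c *
          ∑ k₁ ∈ Icc 1 (⌊M⌋₊ / (c * g)), ∑ k₂ ∈ Icc 1 (⌊M⌋₊ / (c * g)),
            ((μ (c * g * k₁) : ℝ) * ((psi (c * g * k₁))⁻¹ *
                P.eval (Real.log (M / ((c * g * k₁ : ℕ) : ℝ)) / Real.log M))) / ((c * g * k₁ : ℕ) : ℝ) *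
              (((μ (c * g * k₂) : ℝ) * ((psi (c * g * k₂))⁻¹ *
                P.eval (Real.log (M / ((c * g * k₂ : ℕ) : ℝ)) / Real.log M))) / ((c * g * k₂ : ℕ) : ℝ)) *
              (∑ x ∈ s, F x M c g k₁ k₂) -
        K * Real.log M ^ (e) / Real.log M ^ 2| ≤ C * Real.log M ^ (e) / Real.log M ^ 3 := by
  obtain ⟨K, C, hK⟩ := asymp_finset_sum s (fun x M ↦ ∑ c ∈ Icc 1 ⌊M⌋₊, ∑ g ∈ Icc 1 (⌊M⌋₊ / c), (μ g : ℝ) * c *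
            ∑ k₁ ∈ Icc 1 (⌊M⌋₊ / (c * g)), ∑ k₂ ∈ Icc 1 (⌊M⌋₊ / (c * g)),
              ((μ (c * g * k₁) : ℝ) * ((psi (c * g * k₁))⁻¹ *
                  P.eval (Real.log (M / ((c * g * k₁ : ℕ) : ℝ)) / Real.log M))) / ((c * g * k₁ : ℕ) : ℝ) *
                (((μ (c * g * k₂) : ℝ) * ((psi (c * g * k₂))⁻¹ *
                  P.eval (Real.log (M / ((c * g * k₂ : ℕ) : ℝ)) / Real.log M))) / ((c * g * k₂ : ℕ) : ℝ)) *
                (F x M c g k₁ k₂)) e h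
  refine ⟨K, C, fun M hM ↦ ?_⟩
  rw [selbergProd_finset_sum P M s (fun x c g k₁ k₂ ↦ F x M c g k₁ k₂)]
  exact hK M hM

/-- **Scalar multiples of a weight preserve the shape.** [folklore] -/
theorem selbergAsymp_const_mul (e : ℕ) (κ : ℝ) (F : ℝ → ℕ → ℕ → ℕ → ℕ → ℝ)
    (h : ∃ K C : ℝ, ∀ M : ℝ, 3 ≤ M →
      |∑ c ∈ Icc 1 ⌊M⌋₊, ∑ g ∈ Icc 1 (⌊M⌋₊ / c), (μ g : ℝ) * c *
          ∑ k₁ ∈ Icc 1 (⌊M⌋₊ / (c * g)), ∑ k₂ ∈ Icc 1 (⌊M⌋₊ / (c * g)),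
            ((μ (c * g * k₁) : ℝ) * ((psi (c * g * k₁))⁻¹ *
                P.eval (Real.log (M / ((c * g * k₁ : ℕ) : ℝ)) / Real.log M))) / ((c * g * k₁ : ℕ) : ℝ) *
              (((μ (c * g * k₂) : ℝ) * ((psi (c * g * k₂))⁻¹ *
                P.eval (Real.log (M / ((c * g * k₂ : ℕ) : ℝ)) / Real.log M))) / ((c * g * k₂ : ℕ) : ℝ)) *
              (F M c g k₁ k₂) -
        K * Real.log M ^ (e) / Real.log M ^ 2| ≤ C * Real.log M ^ (e) / Real.log M ^ 3) :
    ∃ K C : ℝ, ∀ M : ℝ, 3 ≤ M →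
      |∑ c ∈ Icc 1 ⌊M⌋₊, ∑ g ∈ Icc 1 (⌊M⌋₊ / c), (μ g : ℝ) * c *
          ∑ k₁ ∈ Icc 1 (⌊M⌋₊ / (c * g)), ∑ k₂ ∈ Icc 1 (⌊M⌋₊ / (c * g)),
            ((μ (c * g * k₁) : ℝ) * ((psi (c * g * k₁))⁻¹ *
                P.eval (Real.log (M / ((c * g * k₁ : ℕ) : ℝ)) / Real.log M))) / ((c * g * k₁ : ℕ) : ℝ) *
              (((μ (c * g * k₂) : ℝ) * ((psi (c * g * k₂))⁻¹ *
                P.eval (Real.log (M / ((c * g * k₂ : ℕ) : ℝ)) / Real.log M))) / ((c * g * k₂ : ℕ) : ℝ)) *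
              (κ * F M c g k₁ k₂) -
        K * Real.log M ^ (e) / Real.log M ^ 2| ≤ C * Real.log M ^ (e) / Real.log M ^ 3 := by
  obtain ⟨K, C, hK⟩ := asymp_const_mul κ (fun M ↦ ∑ c ∈ Icc 1 ⌊M⌋₊, ∑ g ∈ Icc 1 (⌊M⌋₊ / c), (μ g : ℝ) * c *
            ∑ k₁ ∈ Icc 1 (⌊M⌋₊ / (c * g)), ∑ k₂ ∈ Icc 1 (⌊M⌋₊ / (c * g)),
              ((μ (c * g * k₁) : ℝ) * ((psi (c * g * k₁))⁻¹ *
                  P.eval (Real.log (M / ((c * g * k₁ : ℕ) : ℝ)) / Real.log M))) / ((c * g * k₁ : ℕ) : ℝ) *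
                (((μ (c * g * k₂) : ℝ) * ((psi (c * g * k₂))⁻¹ *
                  P.eval (Real.log (M / ((c * g * k₂ : ℕ) : ℝ)) / Real.log M))) / ((c * g * k₂ : ℕ) : ℝ)) *
                (F M c g k₁ k₂)) e h
  refine ⟨K, C, fun M hM ↦ ?_⟩
  rw [selbergProd_const_mul P M κ (F M)]
  exact hK M hM

/-- **Sums of two weights preserve the shape.** [folklore] -/
theorem selbergAsymp_add (e : ℕ) (F G : ℝ → ℕ → ℕ → ℕ → ℕ → ℝ)
    (hF : ∃ K C : ℝ, ∀ M : ℝ, 3 ≤ M →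
      |∑ c ∈ Icc 1 ⌊M⌋₊, ∑ g ∈ Icc 1 (⌊M⌋₊ / c), (μ g : ℝ) * c *
          ∑ k₁ ∈ Icc 1 (⌊M⌋₊ / (c * g)), ∑ k₂ ∈ Icc 1 (⌊M⌋₊ / (c * g)),
            ((μ (c * g * k₁) : ℝ) * ((psi (c * g * k₁))⁻¹ *
                P.eval (Real.log (M / ((c * g * k₁ : ℕ) : ℝ)) / Real.log M))) / ((c * g * k₁ : ℕ) : ℝ) *
              (((μ (c * g * k₂) : ℝ) * ((psi (c * g * k₂))⁻¹ *
                P.eval (Real.log (M / ((c * g * k₂ : ℕ) : ℝ)) / Real.log M))) / ((c * g * k₂ : ℕ) : ℝ)) *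
              (F M c g k₁ k₂) -
        K * Real.log M ^ (e) / Real.log M ^ 2| ≤ C * Real.log M ^ (e) / Real.log M ^ 3)
    (hG : ∃ K C : ℝ, ∀ M : ℝ, 3 ≤ M →
      |∑ c ∈ Icc 1 ⌊M⌋₊, ∑ g ∈ Icc 1 (⌊M⌋₊ / c), (μ g : ℝ) * c *
          ∑ k₁ ∈ Icc 1 (⌊M⌋₊ / (c * g)), ∑ k₂ ∈ Icc 1 (⌊M⌋₊ / (c * g)),
            ((μ (c * g * k₁) : ℝ) * ((psi (c * g * k₁))⁻¹ *
                P.eval (Real.log (M / ((c * g * k₁ : ℕ) : ℝ)) / Real.log M))) / ((c * g * k₁ : ℕ) : ℝ) *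
              (((μ (c * g * k₂) : ℝ) * ((psi (c * g * k₂))⁻¹ *
                P.eval (Real.log (M / ((c * g * k₂ : ℕ) : ℝ)) / Real.log M))) / ((c * g * k₂ : ℕ) : ℝ)) *
              (G M c g k₁ k₂) -
        K * Real.log M ^ (e) / Real.log M ^ 2| ≤ C * Real.log M ^ (e) / Real.log M ^ 3) :
    ∃ K C : ℝ, ∀ M : ℝ, 3 ≤ M →
      |∑ c ∈ Icc 1 ⌊M⌋₊, ∑ g ∈ Icc 1 (⌊M⌋₊ / c), (μ g : ℝ) * c *
          ∑ k₁ ∈ Icc 1 (⌊M⌋₊ / (c * g)), ∑ k₂ ∈ Icc 1 (⌊M⌋₊ / (c * g)),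
            ((μ (c * g * k₁) : ℝ) * ((psi (c * g * k₁))⁻¹ *
                P.eval (Real.log (M / ((c * g * k₁ : ℕ) : ℝ)) / Real.log M))) / ((c * g * k₁ : ℕ) : ℝ) *
              (((μ (c * g * k₂) : ℝ) * ((psi (c * g * k₂))⁻¹ *
                P.eval (Real.log (M / ((c * g * k₂ : ℕ) : ℝ)) / Real.log M))) / ((c * g * k₂ : ℕ) : ℝ)) *
              ((F M c g k₁ k₂ + G M c g k₁ k₂)) -
        K * Real.log M ^ (e) / Real.log M ^ 2| ≤ C * Real.log M ^ (e) / Real.log M ^ 3 := by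
  obtain ⟨K, C, hK⟩ := asymp_add (fun M ↦ ∑ c ∈ Icc 1 ⌊M⌋₊, ∑ g ∈ Icc 1 (⌊M⌋₊ / c), (μ g : ℝ) * c *
            ∑ k₁ ∈ Icc 1 (⌊M⌋₊ / (c * g)), ∑ k₂ ∈ Icc 1 (⌊M⌋₊ / (c * g)),
              ((μ (c * g * k₁) : ℝ) * ((psi (c * g * k₁))⁻¹ *
                  P.eval (Real.log (M / ((c * g * k₁ : ℕ) : ℝ)) / Real.log M))) / ((c * g * k₁ : ℕ) : ℝ) *
                (((μ (c * g * k₂) : ℝ) * ((psi (c * g * k₂))⁻¹ *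
                  P.eval (Real.log (M / ((c * g * k₂ : ℕ) : ℝ)) / Real.log M))) / ((c * g * k₂ : ℕ) : ℝ)) *
                (F M c g k₁ k₂))
    (fun M ↦ ∑ c ∈ Icc 1 ⌊M⌋₊, ∑ g ∈ Icc 1 (⌊M⌋₊ / c), (μ g : ℝ) * c *
            ∑ k₁ ∈ Icc 1 (⌊M⌋₊ / (c * g)), ∑ k₂ ∈ Icc 1 (⌊M⌋₊ / (c * g)),
              ((μ (c * g * k₁) : ℝ) * ((psi (c * g * k₁))⁻¹ *
                  P.eval (Real.log (M / ((c * g * k₁ : ℕ) : ℝ)) / Real.log M))) / ((c * g * k₁ : ℕ) : ℝ) *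
                (((μ (c * g * k₂) : ℝ) * ((psi (c * g * k₂))⁻¹ *
                  P.eval (Real.log (M / ((c * g * k₂ : ℕ) : ℝ)) / Real.log M))) / ((c * g * k₂ : ℕ) : ℝ)) *
                (G M c g k₁ k₂)) e hF hG
  refine ⟨K, C, fun M hM ↦ ?_⟩
  rw [selbergProd_add P M (F M) (G M)]
  exact hK M hM

end Summit.Parity.GeneralizedHardyLittlewood.Theorems.MomentsBeyondDiagonal.DiagKernel

end
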